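import Literature.Probability.LatticeModels.LatticeGreenFourCertificate
import HarnessLib

/-!
# The lattice Green function at the origin in `d = 5` and `d = 7`: `R(5) < 6/25`, `R(7) < 369/2324`,
# kernel-checked (Salmhofer–Seiler, CMP 139 (1991), table of `R(ν)` on p. 430)

Companion of `LatticeGreenFourCertificate.lean` (`R(4) < 5/16`).  Salmhofer–Seiler's table (p. 430)
gives the computer-assisted values `R(5) ≤ 0.2313` and `R(7) ≤ 0.1564` of the infrared constant
`R(d) = latticeGreen 0 = ∫_{[-π,π]^d} d^dk/((2π)^d Σ_μ(1 - cos k_μ))`; the Salmhofer–Seiler series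
uses them as HYPOTHESES (`ComplexSpinFluctuationAntipodalBound.u4_chiralLRO_of_latticeGreen_five_lt'`:
`R(5) < 6/25` ⇒ chiral long-range order for the `U(4)` theory in every `ν ≥ 5`;
`u5_chiralLRO_of_latticeGreen_seven_lt`: `R(7) < 369/2324` ⇒ `U(5)` in every `ν ≥ 7`).  Here both
are certified by the Lean kernel, by the method of the companion file plus ONE new analytic step,
the peeling of a coordinate:

* `setIntegral_brillouin_succ_mul` — `∫_{[-π,π]^{d+1}} g(x₀) G(x₁,…,x_d) = ∫g · ∫_{[-π,π]^d} G`
  (Mathlib `measurePreserving_piFinSuccAbove`, `integral_prod_mul`);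
* `setIntegral_sum_cos_pow_succ` — the recursion of the moments
  `W_{d+1}(n) = ∫(Σ_{j≤d} cos xⱼ)^n = Σ_m binom(n,m) · 2πκ(n-m) · W_d(m)` (binomial theorem in the
  peeled coordinate);
* `sum_sum_choose_cosMomentQ_eq` — two peelings regroup into one two-coordinate moment:
  `Σ_{m₁} binom(n,m₁)κ(n-m₁) Σ_m binom(m₁,m)κ(m₁-m) W(m) = Σ_m binom(n,m) k₂(n-m) W(m)`;
* `prob_five_eq_probFiveQ`, `prob_seven_eq_probSevenQ` — **`P(Sₙ = 0)` on `ℤ⁵` and `ℤ⁷` as the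
  computable rationals** `5⁻ⁿ Σ_m binom(n,m) κ(n-m) F₄(m)` and `7⁻ⁿ Σ_m binom(n,m) k₂(n-m) 5^m P⁽⁵⁾_m`
  (`F₄(m) = Σ_i binom(m,i)k₂(i)k₂(m-i) = 4^m P⁽⁴⁾_m` from the companion file);
* `srwHeatKernel_zero_le_of_six_le` — `r(u) ≤ 0.66 u^{-1/2}` for `u ≥ 6` (from
  `srwHeatKernel_zero_le_sharp`);
* kernel evaluation of `Σ_{n<42} P(Sₙ = 0)` (`d = 5`: `≤ 1.1548996`; `d = 7`: `≤ 1.0938538`) and the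
  tails of (A.7) beyond `u = 42/d`, giving **`latticeGreen_five_zero_lt : latticeGreen (0 : Site 5) < 6/25`**
  (indeed `5R(5) ≤ 1.1816`; true `1.1563`) and **`latticeGreen_seven_zero_lt : latticeGreen (0 : Site 7) <
  369/2324`** (`7R(7) ≤ 1.0984`; true `1.0939`).

Honest framing: statements about the simple random walk on `ℤ⁵`, `ℤ⁷`; by themselves they say nothing
about gauge theories.

## References

* M. Salmhofer, E. Seiler, Commun. Math. Phys. 139 (1991) 395–432: Prop. 4.2 (4), Appendix (A.7),
  Lemma A.4, (A.60)–(A.61) and the table of `R(ν)` on p. 430. [SalmhoferSeiler1991]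
* A. J. Guttmann, J. Phys. A 43 (2010) 305205, §2.2 (hypercubic lattice Green functions in all `d`
  as integrals of `I₀^d`; return counts). [Guttmann2010]
-/

noncomputable section

open MeasureTheory Set Filter Finset Real
open scoped Topology BigOperators Nat

namespace Literature.Probability.LatticeModels

variable {d : ℕ}

/-! ### Computable rational data -/

/-- `F₄(m) = Σ_i binom(m,i) k₂(i) k₂(m-i)` (`= 4^m P⁽⁴⁾(S_m = 0)`, `fourSumQ_eq`). [cite: Guttmann2010, §2.2] -/
def fourSumQ (m : ℕ) : ℚ :=
  sumBelow (fun i => binomQ m i * twoCoordMomentQ i * twoCoordMomentQ (m - i)) (m + 1)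

/-- **`P(Sₙ = 0)` on `ℤ⁵` as a computable rational**: `5⁻ⁿ Σ_m binom(n,m) κ(n-m) F₄(m)` (peel one
coordinate off `ℤ⁵ = ℤ × ℤ⁴`). [cite: Guttmann2010, §2.2] -/
def probFiveQ (n : ℕ) : ℚ :=
  sumBelow (fun m => binomQ n m * cosMomentQ (n - m) * fourSumQ m) (n + 1) / (5 : ℚ) ^ n

/-- **`P(Sₙ = 0)` on `ℤ⁷` as a computable rational**: `7⁻ⁿ Σ_m binom(n,m) k₂(n-m) 5^m P⁽⁵⁾_m` (peel
two coordinates off `ℤ⁷ = ℤ² × ℤ⁵`). [cite: Guttmann2010, §2.2] -/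
def probSevenQ (n : ℕ) : ℚ :=
  sumBelow (fun m => binomQ n m * twoCoordMomentQ (n - m) * ((5 : ℚ) ^ m * probFiveQ m)) (n + 1) /
    (7 : ℚ) ^ n

/-- Partial sums `Σ_{n<K} P(Sₙ = 0)` on `ℤ⁵`. [cite: Guttmann2010, §2.2] -/
def probFivePartialQ (K : ℕ) : ℚ := sumBelow probFiveQ K

/-- Partial sums `Σ_{n<K} P(Sₙ = 0)` on `ℤ⁷`. [cite: Guttmann2010, §2.2] -/
def probSevenPartialQ (K : ℕ) : ℚ := sumBelow probSevenQ K

/-- `sumBelow f n = Σ_{i ∈ range n} f i`. [folklore] -/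
private theorem sumBelow_eq_sum_range' (f : ℕ → ℚ) : ∀ n, sumBelow f n = ∑ i ∈ Finset.range n, f i
  | 0 => by simp [sumBelow]
  | (n + 1) => by rw [sumBelow, sumBelow_eq_sum_range' f n, Finset.sum_range_succ]

/-- `binomQ n a = binom(n,a)` for `a ≤ n`. [folklore] -/
private theorem binomQ_eq_choose' {n a : ℕ} (h : a ≤ n) : binomQ n a = (n.choose a : ℚ) := by
  unfold binomQ
  have hfac : ((a ! * (n - a) ! : ℕ) : ℚ) ≠ 0 := by positivity
  rw [div_eq_iff hfac]
  have := Nat.choose_mul_factorial_mul_factorial h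
  rw [← this]
  push_cast
  ring

/-! ### The kernel evaluation -/

/-- `Σ_{n<42} P(Sₙ = 0) ≤ 1.1548996` on `ℤ⁵` (exact rational evaluation by the kernel).
[cite: SalmhoferSeiler1991, p. 430 (`R(5) ≤ 0.2313`)] -/
theorem probFivePartialQ_42_le : probFivePartialQ 42 ≤ 11548996 / 10000000 := by
  decide +kernel

/-- `1.1548995 ≤ Σ_{n<42} P(Sₙ = 0)` on `ℤ⁵`. [cite: SalmhoferSeiler1991, p. 430 (`R(5) ≤ 0.2313`)] -/
theorem le_probFivePartialQ_42 : 11548995 / 10000000 ≤ probFivePartialQ 42 := by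
  decide +kernel

/-- `Σ_{n<42} P(Sₙ = 0) ≤ 1.0938538` on `ℤ⁷` (exact rational evaluation by the kernel).
[cite: SalmhoferSeiler1991, p. 430 (`R(7) ≤ 0.1564`)] -/
theorem probSevenPartialQ_42_le : probSevenPartialQ 42 ≤ 10938538 / 10000000 := by
  decide +kernel

/-- `1.0938536 ≤ Σ_{n<42} P(Sₙ = 0)` on `ℤ⁷`. [cite: SalmhoferSeiler1991, p. 430 (`R(7) ≤ 0.1564`)] -/
theorem le_probSevenPartialQ_42 : 10938536 / 10000000 ≤ probSevenPartialQ 42 := by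
  decide +kernel

/-! ### Peeling a coordinate off the Brillouin zone -/

/-- **Peeling the first coordinate**: `∫_{[-π,π]^{d+1}} g(x₀) G(x₁,…,x_d) dx = ∫_{-π}^{π} g · ∫_{[-π,π]^d} G`
(Mathlib's measurable equivalence `piFinSuccAbove` and `integral_prod_mul`). [folklore] -/
private theorem setIntegral_brillouin_succ_mul (g : ℝ → ℝ) (G : (Fin d → ℝ) → ℝ) :
    ∫ x in brillouin (d + 1), g (x 0) * G (fun j => x (Fin.succ j)) =
      (∫ y in Icc (-π) π, g y) * ∫ z in brillouin d, G z := by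
  rw [volume_restrict_brillouin (d + 1), volume_restrict_brillouin d]
  have hmp := (measurePreserving_piFinSuccAbove
    (fun _ : Fin (d + 1) => (volume : Measure ℝ).restrict (Icc (-π) π)) 0).symm
  rw [← hmp.integral_comp (MeasurableEquiv.measurableEmbedding _)]
  simp only [MeasurableEquiv.piFinSuccAbove_symm_apply, Fin.insertNthEquiv_apply, Fin.insertNth_zero',
    Fin.cons_zero, Fin.cons_succ]
  exact integral_prod_mul g G

/-- **The recursion of the moments in the dimension**:
`∫_{[-π,π]^{d+1}} (Σ_{j≤d} cos xⱼ)^n dx = Σ_{m≤n} binom(n,m) · 2πκ(n-m) · ∫_{[-π,π]^d} (Σ_{j<d} cos zⱼ)^m dz`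
(binomial theorem in the peeled coordinate, Wallis for its moments). [cite: Guttmann2010, §2.2] -/
theorem setIntegral_sum_cos_pow_succ (n : ℕ) :
    ∫ x in brillouin (d + 1), (∑ j, Real.cos (x j)) ^ n =
      ∑ m ∈ Finset.range (n + 1), (n.choose m : ℝ) *
        ((2 * π * (cosMomentQ (n - m) : ℝ)) * ∫ z in brillouin d, (∑ j, Real.cos (z j)) ^ m) := by
  have hpt : ∀ x : Fin (d + 1) → ℝ, (∑ j, Real.cos (x j)) ^ n =
      ∑ m ∈ Finset.range (n + 1), (n.choose m : ℝ) *
        (Real.cos (x 0) ^ (n - m) * (∑ j : Fin d, Real.cos (x (Fin.succ j))) ^ m) := by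
    intro x
    rw [Fin.sum_univ_succ, add_comm, add_pow]
    refine Finset.sum_congr rfl fun m _ => ?_
    ring
  simp_rw [hpt]
  have hK := isCompact_brillouin (d + 1)
  have hint : ∀ m : ℕ, Integrable (fun x : Fin (d + 1) → ℝ => (n.choose m : ℝ) *
      (Real.cos (x 0) ^ (n - m) * (∑ j : Fin d, Real.cos (x (Fin.succ j))) ^ m))
      (volume.restrict (brillouin (d + 1))) := fun m =>
    (by fun_prop : Continuous fun x : Fin (d + 1) → ℝ => (n.choose m : ℝ) *
      (Real.cos (x 0) ^ (n - m) * (∑ j : Fin d, Real.cos (x (Fin.succ j))) ^ m))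
      |>.continuousOn.integrableOn_compact hK
  rw [integral_finsetSum _ fun m _ => hint m]
  refine Finset.sum_congr rfl fun m _ => ?_
  rw [integral_const_mul, setIntegral_brillouin_succ_mul (fun y => Real.cos y ^ (n - m))
    (fun z => (∑ j, Real.cos (z j)) ^ m)]
  have hle : (-π : ℝ) ≤ π := by linarith [Real.pi_pos]
  rw [integral_Icc_eq_integral_Ioc, ← intervalIntegral.integral_of_le hle, intervalIntegral_cos_pow_eq]

/-- **Two peelings regroup into one two-coordinate moment**: for any `W`,
`Σ_{m₁≤n} binom(n,m₁) κ(n-m₁) Σ_{m≤m₁} binom(m₁,m) κ(m₁-m) W(m) = Σ_{m≤n} binom(n,m) k₂(n-m) W(m)`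
(`binom(n,m₁)binom(m₁,m) = binom(n,m)binom(n-m,m₁-m)`, then `Σ_j binom(q,j)κ(j)κ(q-j) = k₂(q)`).
[cite: Guttmann2010, §2.2] -/
theorem sum_sum_choose_cosMomentQ_eq (n : ℕ) (W : ℕ → ℝ) :
    ∑ m₁ ∈ Finset.range (n + 1), (n.choose m₁ : ℝ) * ((cosMomentQ (n - m₁) : ℝ) *
      ∑ m ∈ Finset.range (m₁ + 1), (m₁.choose m : ℝ) * ((cosMomentQ (m₁ - m) : ℝ) * W m)) =
      ∑ m ∈ Finset.range (n + 1), (n.choose m : ℝ) * ((twoCoordMomentQ (n - m) : ℝ) * W m) := by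
  -- expand into a double sum over the triangle `m ≤ m₁ ≤ n` and swap
  have hswap : ∑ m₁ ∈ Finset.range (n + 1), ∑ m ∈ Finset.range (m₁ + 1),
      (n.choose m₁ : ℝ) * (cosMomentQ (n - m₁) : ℝ) * ((m₁.choose m : ℝ) * (cosMomentQ (m₁ - m) : ℝ) * W m) =
      ∑ m ∈ Finset.range (n + 1), ∑ m₁ ∈ Finset.Ico m (n + 1),
        (n.choose m₁ : ℝ) * (cosMomentQ (n - m₁) : ℝ) *
          ((m₁.choose m : ℝ) * (cosMomentQ (m₁ - m) : ℝ) * W m) := by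
    rw [Finset.range_eq_Ico]
    have h := Finset.sum_Ico_Ico_comm 0 (n + 1) fun m m₁ =>
      (n.choose m₁ : ℝ) * (cosMomentQ (n - m₁) : ℝ) * ((m₁.choose m : ℝ) * (cosMomentQ (m₁ - m) : ℝ) * W m)
    rw [h]
    refine Finset.sum_congr rfl fun m₁ _ => ?_
    rw [Finset.range_eq_Ico]
  have hlhs : ∑ m₁ ∈ Finset.range (n + 1), (n.choose m₁ : ℝ) * ((cosMomentQ (n - m₁) : ℝ) *
      ∑ m ∈ Finset.range (m₁ + 1), (m₁.choose m : ℝ) * ((cosMomentQ (m₁ - m) : ℝ) * W m)) =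
      ∑ m₁ ∈ Finset.range (n + 1), ∑ m ∈ Finset.range (m₁ + 1),
        (n.choose m₁ : ℝ) * (cosMomentQ (n - m₁) : ℝ) *
          ((m₁.choose m : ℝ) * (cosMomentQ (m₁ - m) : ℝ) * W m) := by
    refine Finset.sum_congr rfl fun m₁ _ => ?_
    rw [← mul_assoc, Finset.mul_sum]
    refine Finset.sum_congr rfl fun m _ => ?_
    ring
  rw [hlhs, hswap]
  refine Finset.sum_congr rfl fun m hm => ?_
  have hmn : m ≤ n := Nat.lt_succ_iff.1 (Finset.mem_range.1 hm)
  -- the inner sum over `m₁ ∈ [m, n]`, reindexed by `j = m₁ - m`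
  rw [Finset.sum_Ico_eq_sum_range, show n + 1 - m = (n - m) + 1 by omega]
  have hk2 := sum_choose_mul_cosMomentQ (n - m)
  have hk2' : ((twoCoordMomentQ (n - m) : ℚ) : ℝ) =
      ∑ a ∈ Finset.range (n - m + 1), ((n - m).choose a : ℝ) * (cosMomentQ a : ℝ) *
        (cosMomentQ (n - m - a) : ℝ) := by
    rw [← hk2]
    push_cast
    rfl
  rw [hk2', Finset.sum_mul, Finset.mul_sum]
  refine Finset.sum_congr rfl fun j hj => ?_
  have hj' : j ≤ n - m := Nat.lt_succ_iff.1 (Finset.mem_range.1 hj)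
  have hchoose : (n.choose (m + j) : ℝ) * ((m + j).choose m : ℝ) =
      (n.choose m : ℝ) * ((n - m).choose j : ℝ) := by
    have h := Nat.choose_mul (n := n) (k := m + j) (s := m) (Nat.le_add_right m j)
    rw [show m + j - m = j by omega] at h
    exact_mod_cast h
  rw [show m + j - m = j by omega, show n - (m + j) = n - m - j by omega]
  calc (n.choose (m + j) : ℝ) * (cosMomentQ (n - m - j) : ℝ) *
        (((m + j).choose m : ℝ) * (cosMomentQ j : ℝ) * W m)
      = (n.choose (m + j) : ℝ) * ((m + j).choose m : ℝ) *
          ((cosMomentQ (n - m - j) : ℝ) * (cosMomentQ j : ℝ) * W m) := by ring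
    _ = (n.choose m : ℝ) * ((n - m).choose j : ℝ) *
          ((cosMomentQ (n - m - j) : ℝ) * (cosMomentQ j : ℝ) * W m) := by rw [hchoose]
    _ = (n.choose m : ℝ) * (((n - m).choose j : ℝ) * (cosMomentQ j : ℝ) *
          (cosMomentQ (n - m - j) : ℝ) * W m) := by ring

/-! ### The return probabilities on `ℤ⁵` and `ℤ⁷` in closed form -/

/-- `∫_{[-π,π]⁴} (Σⱼ cos zⱼ)^m dz = (2π)⁴ F₄(m)` (the companion file's `prob_four_eq_probFourQ`).
[cite: Guttmann2010, §2.2] -/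
private theorem setIntegral_sum_cos_pow_four (m : ℕ) :
    ∫ z in brillouin 4, (∑ j, Real.cos (z j)) ^ m = (2 * π) ^ 4 * (fourSumQ m : ℝ) := by
  have h1 := SRW.prob_eq_integral (d := 4) (by norm_num) m
  rw [prob_four_eq_probFourQ] at h1
  have hpow : ∀ θ : Fin 4 → ℝ, (((4 : ℕ) : ℝ)⁻¹ * ∑ j, Real.cos (θ j)) ^ m =
      ((4 : ℝ) ^ m)⁻¹ * (∑ j, Real.cos (θ j)) ^ m := fun θ => by
    rw [mul_pow, Nat.cast_ofNat, inv_pow]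
  simp_rw [hpow] at h1
  rw [integral_const_mul] at h1
  have hF : (fourSumQ m : ℚ) = (4 : ℚ) ^ m * probFourQ m := by
    unfold probFourQ fourSumQ
    rw [mul_div_cancel₀ _ (pow_ne_zero m (by norm_num))]
  have h2π : (2 * π : ℝ) ^ 4 ≠ 0 := by positivity
  have h4 : (4 : ℝ) ^ m ≠ 0 := by positivity
  have hI : ∫ z in brillouin 4, (∑ j, Real.cos (z j)) ^ m =
      (2 * π) ^ 4 * (4 : ℝ) ^ m * (probFourQ m : ℝ) := by
    rw [h1]
    field_simp
  rw [hI, hF]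
  push_cast
  ring

/-- **`P(Sₙ = 0)` on `ℤ⁵` in closed form**: `SRW.prob 5 n 0 = probFiveQ n`. [cite: Guttmann2010, §2.2] -/
theorem prob_five_eq_probFiveQ (n : ℕ) : SRW.prob 5 n 0 = (probFiveQ n : ℝ) := by
  rw [SRW.prob_eq_integral (by norm_num) n]
  have hpow : ∀ θ : Fin 5 → ℝ, (((5 : ℕ) : ℝ)⁻¹ * ∑ j, Real.cos (θ j)) ^ n =
      ((5 : ℝ) ^ n)⁻¹ * (∑ j, Real.cos (θ j)) ^ n := fun θ => by
    rw [mul_pow, Nat.cast_ofNat, inv_pow]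
  simp_rw [hpow]
  rw [integral_const_mul, setIntegral_sum_cos_pow_succ (d := 4) n]
  simp_rw [setIntegral_sum_cos_pow_four]
  unfold probFiveQ
  rw [sumBelow_eq_sum_range']
  push_cast
  simp only [Finset.sum_div, Finset.mul_sum]
  refine Finset.sum_congr rfl fun m hm => ?_
  rw [binomQ_eq_choose' (Nat.lt_succ_iff.1 (Finset.mem_range.1 hm))]
  push_cast
  have h2π : (2 * π : ℝ) ≠ 0 := by positivity
  have h5 : (5 : ℝ) ^ n ≠ 0 := by positivity
  field_simp

/-- **`P(Sₙ = 0)` on `ℤ⁷` in closed form**: `SRW.prob 7 n 0 = probSevenQ n` (peel `ℤ⁷ = ℤ × ℤ × ℤ⁵`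
and regroup the two peelings into the two-coordinate moment `k₂`). [cite: Guttmann2010, §2.2] -/
theorem prob_seven_eq_probSevenQ (n : ℕ) : SRW.prob 7 n 0 = (probSevenQ n : ℝ) := by
  rw [SRW.prob_eq_integral (by norm_num) n]
  have hpow : ∀ θ : Fin 7 → ℝ, (((7 : ℕ) : ℝ)⁻¹ * ∑ j, Real.cos (θ j)) ^ n =
      ((7 : ℝ) ^ n)⁻¹ * (∑ j, Real.cos (θ j)) ^ n := fun θ => by
    rw [mul_pow, Nat.cast_ofNat, inv_pow]
  simp_rw [hpow]
  rw [integral_const_mul, setIntegral_sum_cos_pow_succ (d := 6) n]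
  simp_rw [setIntegral_sum_cos_pow_succ (d := 5)]
  -- the inner `d = 5` integrals are `(2π)^5 5^m probFiveQ m`
  have h5 : ∀ m : ℕ, ∫ z in brillouin 5, (∑ j, Real.cos (z j)) ^ m =
      (2 * π) ^ 5 * ((5 : ℝ) ^ m * (probFiveQ m : ℝ)) := by
    intro m
    have h := SRW.prob_eq_integral (d := 5) (by norm_num) m
    rw [prob_five_eq_probFiveQ] at h
    have hpow' : ∀ θ : Fin 5 → ℝ, (((5 : ℕ) : ℝ)⁻¹ * ∑ j, Real.cos (θ j)) ^ m =
        ((5 : ℝ) ^ m)⁻¹ * (∑ j, Real.cos (θ j)) ^ m := fun θ => by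
      rw [mul_pow, Nat.cast_ofNat, inv_pow]
    simp_rw [hpow'] at h
    rw [integral_const_mul] at h
    have h2π : (2 * π : ℝ) ^ 5 ≠ 0 := by positivity
    have h5' : (5 : ℝ) ^ m ≠ 0 := by positivity
    rw [h]
    field_simp
  simp_rw [h5]
  -- regroup the two peelings
  have hre : ∀ m₁ ∈ Finset.range (n + 1), (n.choose m₁ : ℝ) * ((2 * π * (cosMomentQ (n - m₁) : ℝ)) *
      ∑ m ∈ Finset.range (m₁ + 1), (m₁.choose m : ℝ) * ((2 * π * (cosMomentQ (m₁ - m) : ℝ)) *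
        ((2 * π) ^ 5 * ((5 : ℝ) ^ m * (probFiveQ m : ℝ))))) =
      (2 * π) ^ 7 * ((n.choose m₁ : ℝ) * ((cosMomentQ (n - m₁) : ℝ) *
        ∑ m ∈ Finset.range (m₁ + 1), (m₁.choose m : ℝ) * ((cosMomentQ (m₁ - m) : ℝ) *
          ((5 : ℝ) ^ m * (probFiveQ m : ℝ))))) := by
    intro m₁ _
    simp only [Finset.mul_sum]
    refine Finset.sum_congr rfl fun m _ => ?_
    ring
  rw [Finset.sum_congr rfl hre, ← Finset.mul_sum,
    sum_sum_choose_cosMomentQ_eq n (fun m => (5 : ℝ) ^ m * (probFiveQ m : ℝ))]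
  unfold probSevenQ
  rw [sumBelow_eq_sum_range']
  push_cast
  simp only [Finset.sum_div, Finset.mul_sum]
  refine Finset.sum_congr rfl fun m hm => ?_
  rw [binomQ_eq_choose' (Nat.lt_succ_iff.1 (Finset.mem_range.1 hm))]
  push_cast
  have h2π : (2 * π : ℝ) ≠ 0 := by positivity
  have h7 : (7 : ℝ) ^ n ≠ 0 := by positivity
  field_simp

/-- `Σ_{n<K} P(Sₙ = 0) = probFivePartialQ K` on `ℤ⁵`. [cite: Guttmann2010, §2.2] -/
theorem sum_range_prob_five_eq (K : ℕ) :
    ∑ n ∈ Finset.range K, SRW.prob 5 n 0 = (probFivePartialQ K : ℝ) := by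
  unfold probFivePartialQ
  rw [sumBelow_eq_sum_range']
  push_cast
  exact Finset.sum_congr rfl fun n _ => prob_five_eq_probFiveQ n

/-- `Σ_{n<K} P(Sₙ = 0) = probSevenPartialQ K` on `ℤ⁷`. [cite: Guttmann2010, §2.2] -/
theorem sum_range_prob_seven_eq (K : ℕ) :
    ∑ n ∈ Finset.range K, SRW.prob 7 n 0 = (probSevenPartialQ K : ℝ) := by
  unfold probSevenPartialQ
  rw [sumBelow_eq_sum_range']
  push_cast
  exact Finset.sum_congr rfl fun n _ => prob_seven_eq_probSevenQ n

/-! ### `r(u) ≤ 0.66 u^{-1/2}` for `u ≥ 6`, and the tails of (A.7) -/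

/-- `e^{-4u/9} √u ≤ e^{-2} √6` for `u ≥ 6` (`√(u/6) ≤ 1 + 4(u-6)/9 ≤ e^{4(u-6)/9}`, `e^{-8/3} ≤ e^{-2}`).
[folklore] -/
private theorem exp_neg_mul_sqrt_le_six {u : ℝ} (hu : 6 ≤ u) :
    Real.exp (-(4 / 9 * u)) * Real.sqrt u ≤ Real.exp (-2) * Real.sqrt 6 := by
  set v : ℝ := 4 / 9 * (u - 6) with hv
  have hv0 : 0 ≤ v := by rw [hv]; linarith
  have h1 : Real.sqrt u ≤ Real.sqrt 6 * (1 + v) := by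
    have h6 : Real.sqrt 6 * (1 + v) = Real.sqrt (6 * (1 + v) ^ 2) := by
      rw [Real.sqrt_mul (by norm_num), Real.sqrt_sq (by linarith)]
    rw [h6]
    exact Real.sqrt_le_sqrt (by rw [hv]; nlinarith)
  have h2 : 1 + v ≤ Real.exp v := by linarith [Real.add_one_le_exp v]
  have h3 : Real.sqrt u ≤ Real.sqrt 6 * Real.exp v :=
    h1.trans (mul_le_mul_of_nonneg_left h2 (Real.sqrt_nonneg _))
  have h4 : Real.exp (-(4 / 9 * u)) * Real.exp v = Real.exp (-(8 / 3)) := by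
    rw [← Real.exp_add]
    congr 1
    rw [hv]
    ring
  have h5 : Real.exp (-(8 / 3 : ℝ)) ≤ Real.exp (-2) := Real.exp_le_exp.2 (by norm_num)
  calc Real.exp (-(4 / 9 * u)) * Real.sqrt u
      ≤ Real.exp (-(4 / 9 * u)) * (Real.sqrt 6 * Real.exp v) :=
        mul_le_mul_of_nonneg_left h3 (Real.exp_pos _).le
    _ = Real.exp (-(4 / 9 * u)) * Real.exp v * Real.sqrt 6 := by ring
    _ = Real.exp (-(8 / 3)) * Real.sqrt 6 := by rw [h4]
    _ ≤ Real.exp (-2) * Real.sqrt 6 := mul_le_mul_of_nonneg_right h5 (Real.sqrt_nonneg _)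

/-- `e^{-2} √6 ≤ 0.332` (`e^{-1} < 0.3678794412`, `√6 < 2.4495`). [folklore] -/
private theorem exp_neg_two_mul_sqrt_six_le : Real.exp (-2) * Real.sqrt 6 ≤ 332 / 1000 := by
  have he : Real.exp (-2) = Real.exp (-1) ^ 2 := by
    rw [← Real.exp_nat_mul]; norm_num
  have he1 : Real.exp (-1) ^ 2 ≤ (0.3678794412 : ℝ) ^ 2 :=
    pow_le_pow_left₀ (Real.exp_pos _).le Real.exp_neg_one_lt_d9.le 2
  have hs : Real.sqrt 6 ≤ 2.4495 := by
    rw [Real.sqrt_le_left (by norm_num)]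
    norm_num
  rw [he]
  calc Real.exp (-1) ^ 2 * Real.sqrt 6 ≤ (0.3678794412 : ℝ) ^ 2 * 2.4495 :=
        mul_le_mul he1 hs (Real.sqrt_nonneg _) (by positivity)
    _ ≤ 332 / 1000 := by norm_num

/-- **`r(u) ≤ 0.66 u^{-1/2}` for `u ≥ 6`** (from `srwHeatKernel_zero_le_sharp`; the constant absorbs
the exponentially small antipodal term at these moderate `u`). [cite: SalmhoferSeiler1991, Lemma A.4 (A.22)] -/
theorem srwHeatKernel_zero_le_of_six_le {u : ℝ} (hu : 6 ≤ u) :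
    srwHeatKernel u 0 ≤ 66 / 100 / Real.sqrt u := by
  have hu0 : 0 < u := by linarith
  have hsu : 0 < Real.sqrt u := Real.sqrt_pos.2 hu0
  have h := srwHeatKernel_zero_le_sharp hu0
  have hA : Real.sqrt (π / (43 / 96 * u)) / (2 * π) ≤ 4225 / 10000 / Real.sqrt u := by
    rw [div_le_div_iff₀ (by positivity) hsu]
    have hmul : Real.sqrt (π / (43 / 96 * u)) * Real.sqrt u = Real.sqrt (π / (43 / 96)) := by
      rw [← Real.sqrt_mul (by positivity)]
      congr 1
      field_simp
    rw [hmul, Real.sqrt_le_left (by positivity)]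
    nlinarith [Real.pi_gt_d2, Real.pi_pos]
  have hB : (π - 1) / π * Real.exp (-(4 / 9 * u)) ≤ 2375 / 10000 / Real.sqrt u := by
    have hfrac : (π - 1) / π ≤ 69 / 100 := by
      rw [div_le_iff₀ Real.pi_pos]
      linarith [Real.pi_lt_d2]
    have hfrac0 : 0 ≤ (π - 1) / π := div_nonneg (by linarith [Real.pi_gt_three]) Real.pi_pos.le
    have hkey : Real.exp (-(4 / 9 * u)) ≤ 332 / 1000 / Real.sqrt u := by
      rw [le_div_iff₀ hsu]
      exact (exp_neg_mul_sqrt_le_six hu).trans exp_neg_two_mul_sqrt_six_le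
    calc (π - 1) / π * Real.exp (-(4 / 9 * u)) ≤ 69 / 100 * (332 / 1000 / Real.sqrt u) :=
          mul_le_mul hfrac hkey (Real.exp_pos _).le (by norm_num)
      _ ≤ 2375 / 10000 / Real.sqrt u := by
          rw [← mul_div_assoc]
          exact div_le_div_of_nonneg_right (by norm_num) hsu.le
  calc srwHeatKernel u 0 ≤ _ := h
    _ ≤ 4225 / 10000 / Real.sqrt u + 2375 / 10000 / Real.sqrt u := add_le_add hA hB
    _ = 66 / 100 / Real.sqrt u := by rw [← add_div]; norm_num

/-- For `u ≥ c > 0`: `r(u)^5 ≤ 0.66⁵ (u²)⁻¹ (√c)⁻¹` (`c ≥ 6`). [cite: SalmhoferSeiler1991, Lemma A.4 (A.22)] -/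
private theorem srwHeatKernel_zero_pow_five_le {c u : ℝ} (hc : 6 ≤ c) (hu : c ≤ u) :
    srwHeatKernel u 0 ^ 5 ≤ (66 / 100) ^ 5 * ((u ^ 2)⁻¹ * (Real.sqrt c)⁻¹) := by
  have hu0 : 0 < u := by linarith
  have hsu : 0 < Real.sqrt u := Real.sqrt_pos.2 hu0
  have hsc : 0 < Real.sqrt c := Real.sqrt_pos.2 (by linarith)
  have h := pow_le_pow_left₀ (srwHeatKernel_zero_nonneg u)
    (srwHeatKernel_zero_le_of_six_le (by linarith : 6 ≤ u)) 5
  rw [div_pow] at h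
  refine h.trans ?_
  rw [div_eq_mul_inv]
  refine mul_le_mul_of_nonneg_left ?_ (by positivity)
  have hsq : Real.sqrt u ^ 5 = u ^ 2 * Real.sqrt u := by
    rw [show (5 : ℕ) = 2 * 2 + 1 from rfl, pow_succ, pow_mul, Real.sq_sqrt hu0.le]
  rw [hsq, mul_inv]
  exact mul_le_mul_of_nonneg_left ((inv_le_inv₀ hsu hsc).2 (Real.sqrt_le_sqrt hu)) (by positivity)

/-- For `u ≥ c ≥ 6`: `r(u)^7 ≤ 0.66⁷ (u²)⁻¹ (√c)⁻³`. [cite: SalmhoferSeiler1991, Lemma A.4 (A.22)] -/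
private theorem srwHeatKernel_zero_pow_seven_le {c u : ℝ} (hc : 6 ≤ c) (hu : c ≤ u) :
    srwHeatKernel u 0 ^ 7 ≤ (66 / 100) ^ 7 * ((u ^ 2)⁻¹ * (Real.sqrt c ^ 3)⁻¹) := by
  have hu0 : 0 < u := by linarith
  have hsu : 0 < Real.sqrt u := Real.sqrt_pos.2 hu0
  have hsc : 0 < Real.sqrt c := Real.sqrt_pos.2 (by linarith)
  have h := pow_le_pow_left₀ (srwHeatKernel_zero_nonneg u)
    (srwHeatKernel_zero_le_of_six_le (by linarith : 6 ≤ u)) 7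
  rw [div_pow] at h
  refine h.trans ?_
  rw [div_eq_mul_inv]
  refine mul_le_mul_of_nonneg_left ?_ (by positivity)
  have hsq : Real.sqrt u ^ 7 = u ^ 2 * Real.sqrt u ^ 3 := by
    rw [show (7 : ℕ) = 2 * 2 + 3 from rfl, pow_add, pow_mul, Real.sq_sqrt hu0.le]
  rw [hsq, mul_inv]
  refine mul_le_mul_of_nonneg_left ?_ (by positivity)
  exact (inv_le_inv₀ (by positivity) (by positivity)).2
    (pow_le_pow_left₀ hsc.le (Real.sqrt_le_sqrt hu) 3)

/-- `∫_c^∞ (u²)⁻¹ du = c⁻¹` with integrability (`c > 0`). [folklore] -/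
private theorem integral_Ioi_inv_sq {c : ℝ} (hc : 0 < c) :
    IntegrableOn (fun u : ℝ => (u ^ 2)⁻¹) (Ioi c) ∧ ∫ u in Ioi c, (u ^ 2)⁻¹ = c⁻¹ := by
  have hcongr : ∀ u ∈ Ioi c, (u : ℝ) ^ (-2 : ℝ) = (u ^ 2)⁻¹ := fun u hu => by
    rw [Real.rpow_neg (le_of_lt (hc.trans hu)), Real.rpow_two]
  have hint := integrableOn_Ioi_rpow_of_lt (by norm_num : (-2 : ℝ) < -1) hc
  have hval := integral_Ioi_rpow_of_lt (by norm_num : (-2 : ℝ) < -1) hc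
  refine ⟨(integrableOn_congr_fun hcongr measurableSet_Ioi).1 hint, ?_⟩
  rw [← setIntegral_congr_fun measurableSet_Ioi hcongr, hval]
  rw [show (-2 : ℝ) + 1 = -1 by norm_num, Real.rpow_neg_one]
  ring

/-- **The tail of (A.7) in `ν = 5` beyond `u = 42/5`**: `∫_{8.4}^∞ r⁵ ≤ 0.66⁵/(8.4 √8.4) ≤ 0.0052`.
[cite: SalmhoferSeiler1991, Appendix (A.7), Lemma A.4] -/
theorem integral_Ioi_srwHeatKernel_zero_pow_five_le :
    ∫ u in Ioi (42 / 5 : ℝ), srwHeatKernel u 0 ^ 5 ≤ 52 / 10000 := by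
  have hc : (0 : ℝ) < 42 / 5 := by norm_num
  obtain ⟨hint, -⟩ := setIntegral_exp_mul_inv_dispersion_eq (d := 5) (by norm_num) hc.le
  obtain ⟨hmaj0, hval0⟩ := integral_Ioi_inv_sq hc
  have hmaj := hmaj0.const_mul ((66 / 100 : ℝ) ^ 5 * (Real.sqrt (42 / 5))⁻¹)
  have hle : ∫ u in Ioi (42 / 5 : ℝ), srwHeatKernel u 0 ^ 5 ≤
      ∫ u in Ioi (42 / 5 : ℝ), (66 / 100 : ℝ) ^ 5 * (Real.sqrt (42 / 5))⁻¹ * (u ^ 2)⁻¹ := by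
    refine setIntegral_mono_on hint hmaj measurableSet_Ioi fun u hu => ?_
    have h := srwHeatKernel_zero_pow_five_le (by norm_num : (6 : ℝ) ≤ 42 / 5) (le_of_lt hu)
    calc srwHeatKernel u 0 ^ 5 ≤ (66 / 100) ^ 5 * ((u ^ 2)⁻¹ * (Real.sqrt (42 / 5))⁻¹) := h
      _ = (66 / 100 : ℝ) ^ 5 * (Real.sqrt (42 / 5))⁻¹ * (u ^ 2)⁻¹ := by ring
  rw [integral_const_mul, hval0] at hle
  have hs : (2.898 : ℝ) ≤ Real.sqrt (42 / 5) := Real.le_sqrt_of_sq_le (by norm_num)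
  have hsinv : (Real.sqrt (42 / 5))⁻¹ ≤ 1 / 2.898 := by
    rw [one_div]; exact (inv_le_inv₀ (by positivity) (by norm_num)).2 hs
  refine hle.trans ?_
  calc (66 / 100 : ℝ) ^ 5 * (Real.sqrt (42 / 5))⁻¹ * (42 / 5 : ℝ)⁻¹
      ≤ (66 / 100 : ℝ) ^ 5 * (1 / 2.898) * (42 / 5 : ℝ)⁻¹ := by gcongr
    _ ≤ 52 / 10000 := by norm_num

/-- **The tail of (A.7) in `ν = 7` beyond `u = 6`**: `∫_6^∞ r⁷ ≤ 0.66⁷/(6 (√6)³) ≤ 0.00063`.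
[cite: SalmhoferSeiler1991, Appendix (A.7), Lemma A.4] -/
theorem integral_Ioi_srwHeatKernel_zero_pow_seven_le :
    ∫ u in Ioi (6 : ℝ), srwHeatKernel u 0 ^ 7 ≤ 63 / 100000 := by
  have hc : (0 : ℝ) < 6 := by norm_num
  obtain ⟨hint, -⟩ := setIntegral_exp_mul_inv_dispersion_eq (d := 7) (by norm_num) hc.le
  obtain ⟨hmaj0, hval0⟩ := integral_Ioi_inv_sq hc
  have hmaj := hmaj0.const_mul ((66 / 100 : ℝ) ^ 7 * (Real.sqrt 6 ^ 3)⁻¹)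
  have hle : ∫ u in Ioi (6 : ℝ), srwHeatKernel u 0 ^ 7 ≤
      ∫ u in Ioi (6 : ℝ), (66 / 100 : ℝ) ^ 7 * (Real.sqrt 6 ^ 3)⁻¹ * (u ^ 2)⁻¹ := by
    refine setIntegral_mono_on hint hmaj measurableSet_Ioi fun u hu => ?_
    have h := srwHeatKernel_zero_pow_seven_le (le_refl (6 : ℝ)) (le_of_lt hu)
    calc srwHeatKernel u 0 ^ 7 ≤ (66 / 100) ^ 7 * ((u ^ 2)⁻¹ * (Real.sqrt 6 ^ 3)⁻¹) := h
      _ = (66 / 100 : ℝ) ^ 7 * (Real.sqrt 6 ^ 3)⁻¹ * (u ^ 2)⁻¹ := by ring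
  rw [integral_const_mul, hval0] at hle
  have hs : (2.449 : ℝ) ≤ Real.sqrt 6 := Real.le_sqrt_of_sq_le (by norm_num)
  have hsinv : (Real.sqrt 6 ^ 3)⁻¹ ≤ 1 / 2.449 ^ 3 := by
    rw [one_div]
    exact (inv_le_inv₀ (by positivity) (by norm_num)).2 (pow_le_pow_left₀ (by norm_num) hs 3)
  refine hle.trans ?_
  calc (66 / 100 : ℝ) ^ 7 * (Real.sqrt 6 ^ 3)⁻¹ * (6 : ℝ)⁻¹
      ≤ (66 / 100 : ℝ) ^ 7 * (1 / 2.449 ^ 3) * (6 : ℝ)⁻¹ := by gcongr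
    _ ≤ 63 / 100000 := by norm_num

/-! ### The certificates -/

/-- **`5 R(5) ≤ 1.1816`** (`Σ_{n<42} P + 5∫_{8.4}^∞ r⁵ + r(8.4)⁵`; true value `1.1563`).
[cite: SalmhoferSeiler1991, p. 430 (`R(5) ≤ 0.2313`)] -/
theorem five_mul_latticeGreen_five_zero_le : 5 * latticeGreen (0 : Site 5) ≤ 11816 / 10000 := by
  have hIcc := (sum_range_prob_zero_mem_Icc (d := 5) (by norm_num) 42).1
  have h42 : ((42 : ℕ) : ℝ) / ((5 : ℕ) : ℝ) = 42 / 5 := by norm_num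
  rw [h42, sum_range_prob_five_eq] at hIcc
  have hP : ((probFivePartialQ 42 : ℚ) : ℝ) ≤ 11548996 / 10000000 := by
    have h := (Rat.cast_le (K := ℝ)).2 probFivePartialQ_42_le
    push_cast at h
    exact h
  have hT := integral_Ioi_srwHeatKernel_zero_pow_five_le
  have hr : srwHeatKernel (42 / 5) 0 ^ 5 ≤ (66 / 100) ^ 5 * ((((42 / 5 : ℝ)) ^ 2)⁻¹ *
      (Real.sqrt (42 / 5))⁻¹) := srwHeatKernel_zero_pow_five_le (by norm_num) le_rfl
  have hs : (2.898 : ℝ) ≤ Real.sqrt (42 / 5) := Real.le_sqrt_of_sq_le (by norm_num)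
  have hsinv : (Real.sqrt (42 / 5))⁻¹ ≤ 1 / 2.898 := by
    rw [one_div]; exact (inv_le_inv₀ (by positivity) (by norm_num)).2 hs
  have hr' : srwHeatKernel (42 / 5) 0 ^ 5 ≤ (66 / 100) ^ 5 * ((((42 / 5 : ℝ)) ^ 2)⁻¹ * (1 / 2.898)) :=
    hr.trans (by gcongr)
  push_cast at hIcc
  nlinarith

/-- **`R(5) = latticeGreen 0 < 6/25`** in `d = 5` — the computer-assisted input (`R(5) ≤ 0.2313`,
p. 430) of the `U(4)`, `ν ≥ 5` case, now kernel-checked.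
[cite: SalmhoferSeiler1991, Prop. 4.2 (4) and p. 430] -/
theorem latticeGreen_five_zero_lt : latticeGreen (0 : Site 5) < 6 / 25 := by
  linarith [five_mul_latticeGreen_five_zero_le]

/-- **`7 R(7) ≤ 1.0984`** (`Σ_{n<42} P + 7∫_6^∞ r⁷ + r(6)⁷`; true value `1.0939`).
[cite: SalmhoferSeiler1991, p. 430 (`R(7) ≤ 0.1564`)] -/
theorem seven_mul_latticeGreen_seven_zero_le : 7 * latticeGreen (0 : Site 7) ≤ 10984 / 10000 := by
  have hIcc := (sum_range_prob_zero_mem_Icc (d := 7) (by norm_num) 42).1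
  have h42 : ((42 : ℕ) : ℝ) / ((7 : ℕ) : ℝ) = 6 := by norm_num
  rw [h42, sum_range_prob_seven_eq] at hIcc
  have hP : ((probSevenPartialQ 42 : ℚ) : ℝ) ≤ 10938538 / 10000000 := by
    have h := (Rat.cast_le (K := ℝ)).2 probSevenPartialQ_42_le
    push_cast at h
    exact h
  have hT := integral_Ioi_srwHeatKernel_zero_pow_seven_le
  have hr : srwHeatKernel 6 0 ^ 7 ≤ (66 / 100) ^ 7 * (((6 : ℝ) ^ 2)⁻¹ * (Real.sqrt 6 ^ 3)⁻¹) :=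
    srwHeatKernel_zero_pow_seven_le (le_refl (6 : ℝ)) le_rfl
  have hs : (2.449 : ℝ) ≤ Real.sqrt 6 := Real.le_sqrt_of_sq_le (by norm_num)
  have hsinv : (Real.sqrt 6 ^ 3)⁻¹ ≤ 1 / 2.449 ^ 3 := by
    rw [one_div]
    exact (inv_le_inv₀ (by positivity) (by norm_num)).2 (pow_le_pow_left₀ (by norm_num) hs 3)
  have hr' : srwHeatKernel 6 0 ^ 7 ≤ (66 / 100) ^ 7 * (((6 : ℝ) ^ 2)⁻¹ * (1 / 2.449 ^ 3)) :=
    hr.trans (by gcongr)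
  push_cast at hIcc
  nlinarith

/-- **`R(7) = latticeGreen 0 < 369/2324`** in `d = 7` — the computer-assisted input (`R(7) ≤ 0.1564`,
p. 430) of the `U(5)`, `ν ≥ 7` case (with the corrected `K(5) = 12227/1330`), now kernel-checked.
[cite: SalmhoferSeiler1991, Prop. 4.2 (4) and p. 430] -/
theorem latticeGreen_seven_zero_lt : latticeGreen (0 : Site 7) < 369 / 2324 := by
  have h := seven_mul_latticeGreen_seven_zero_le
  norm_num at h ⊢
  linarith

end Literature.Probability.LatticeModels
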